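import Summits.Langlands.Langlands.Theorems.SqrtFiveQuarticCoversRank0TwentyOneTwist525
import Summits.Langlands.Langlands.Theorems.SqrtFiveQuarticCoversRank0FifteenSqrtFive
import Literature.NumberTheory.EllipticCurves.Curve21A1Points
import Literature.NumberTheory.EllipticCurves.ComplexMultiplicationBurungaleFlachFiniteProofs
import Literature.NumberTheory.EllipticCurves.VariableChangePointsMap
import HarnessLib

/-!
# Route `Langlands/SqrtFiveQuarticCovers` — the isogeny class `21a` has rank `0` over `ℚ(√5)`:
# `X₀(21)` has finitely many points over every quadratic field containing `√5`

Cell lg-quartmod (F-L1), seat eng-8 g4 (self-scoped optional item (E21) under the wind-down ruling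
director-frontier g15 2026-08-29T00:46:47Z (a); helper of stmt-Langlands-23416), companion of
`…Rank0TwentyOneTwist525.lean`; sibling of eng-6 g4's `…Rank0FifteenSqrtFive.lean` (p683123), whose
layout it follows VERBATIM.  MAIN THEOREM

* `finite_point_X0_21_of_sq_eq_five (K) (hK : finrank ℚ K = 2) (hr : r ^ 2 = 5) :`
  `Finite (⟨1, 0, 0, -4, -1⟩ : WeierstrassCurve K).toAffine.Point`

— for every quadratic field `K` and `r ∈ K` with `r² = 5` (so `K = ℚ(√5)`), the curve
`X₀(21) = 21A1 : y² + xy = x³ − 4x − 1` has finitely many `K`-points; equivalently the isogeny class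
`21a` has Mordell–Weil RANK `0` over `k = ℚ(√5)`.  This is the rank half of the LAST named rank-`0`
input of sheet 4.5's fourth lineage E10X (eng-1 g3, E10X-REPORT 21347fd33ceba04b §3: «`E₂₁(k)` = 8
points» from `L(21a,1)·L(21a⊗χ₅,1) ≠ 0` + Kolyvagin–Logachev), now a kernel theorem; the torsion
half (`E₂₁(k)_tors = ℤ/4 × ℤ/2`, eng-1 `elltors`) stays a computed datum of that lineage document, and
over `ℚ` the full list is the tree's `Curve21A1.mem_points_of_equation`.

PROOF (assembly of PROVED tree material, no new mathematics):
1. `Curve21A1.finite_point : Finite (21A1)(ℚ)` (complete `2`-descent, `Curve21A1Descent.lean`; `21A1` is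
   elliptic, `Δ = 3969 = 3⁴·7²`: `Curve21A1.Δ_eq_and_isElliptic`, `Curve21A1Points.lean`);
2. `Twist525.finite_point : Finite (T₅₂₅)(ℚ)` for `T₅₂₅ = ⟨0, 5, 0, -1600, -8000⟩` (module 2 of this
   item), and `T₅₂₅ = (1/2, 0, 0, 0) • (21A1).quadraticTwist 5` (`smul_quadraticTwist_five`, by `ext`),
   so `Finite ((21A1).quadraticTwist 5)(ℚ)` through `VariableChange.pointEquiv`;
3. `WeierstrassCurve.finite_point_baseChange_of_finite_of_finite_quadraticTwist` (Silverman *AEC*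
   Exercise 10.16 in finiteness form, `ComplexMultiplicationBurungaleFlachFiniteProofs.lean`): for
   `K = ℚ(θ)`, `θ² = c`, `θ ∉ ℚ`, `[K:ℚ] = 2`, `E(ℚ)` and `E^{(c)}(ℚ)` finite ⇒ `E(K)` finite — with
   `θ = r`, `c = 5` (`r ∉ ℚ`: `Rank0Fifteen.sqrt_five_not_mem_range`, p683123);
4. `(21A1).baseChange K = ⟨1, 0, 0, -4, -1⟩` over `K` (`baseChange_eq`).

HONEST STATUS: unconditional kernel theorem about the `K`-points of ONE explicit elliptic curve over
the quadratic fields `K ∋ √5`; rank `0` is not a BSD statement and not a modularity statement; it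
closes no binder of the route's Record (it converts a named rank-`0` input INSIDE one lineage document
of sheet 4.5 into a kernel theorem; row 7 `hK1inf` is a model identification and stays named).
Nothing here proves modularity of a new class of elliptic curves.  References: [SilvermanAEC2009]
X.1.4/X.1.5, VIII.6.7, Exercise 10.16; [CremonaAlgorithms1997] Table 1 (`N = 21`);
[FreitasLeHungSiksek2015] §5.4 (the curve `X₀(21)`, p. 35).
-/

noncomputable section

open scoped Classical

set_option linter.dupNamespace false -- project-wide option; `Summit.Langlands.Langlands` is the mandated namespace

namespace Summit.Langlands.Langlands.Theorems.SqrtFiveQuarticCovers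

namespace Rank0TwentyOne

open _root_.WeierstrassCurve Literature.NumberTheory.EllipticCurves

/-- **The twist of `X₀(21)` by `5` is `T₅₂₅` up to the rescaling `u = 1/2`**:
`(1/2, 0, 0, 0) • (21A1).quadraticTwist 5 = ⟨0, 5, 0, -1600, -8000⟩` (the tree's `quadraticTwist 5`
of `[1, 0, 0, -4, -1]` is `⟨0, 5/4, 0, -100, -125⟩`; `b₂ = 1`, `b₄ = -8`, `b₆ = -4`). [folklore] -/
theorem smul_quadraticTwist_five :
    (⟨⟨(1 / 2 : ℚ), 2, by norm_num, by norm_num⟩, 0, 0, 0⟩ : VariableChange ℚ) •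
        (⟨1, 0, 0, -4, -1⟩ : WeierstrassCurve ℚ).quadraticTwist 5 =
      (⟨0, 5, 0, -1600, -8000⟩ : WeierstrassCurve ℚ) := by
  ext
  · simp [variableChange_a₁]
  · simp only [variableChange_a₂, quadraticTwist_a₁, quadraticTwist_a₂, b₂]
    norm_num
  · simp [variableChange_a₃]
  · simp only [variableChange_a₄, quadraticTwist_a₁, quadraticTwist_a₂, quadraticTwist_a₃,
      quadraticTwist_a₄, b₂, b₄]
    norm_num
  · simp only [variableChange_a₆, quadraticTwist_a₁, quadraticTwist_a₂, quadraticTwist_a₃,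
      quadraticTwist_a₄, quadraticTwist_a₆, b₂, b₄, b₆]
    norm_num

/-- **The quadratic twist of `X₀(21)` by `5` has finitely many rational points** (rank `0` of
`21a1 ⊗ χ₅`, conductor `525`): transport of `Twist525.finite_point` along the change of variables
`smul_quadraticTwist_five` (`VariableChange.pointEquiv`). [cite: SilvermanAEC2009, Prop. X.1.4 and Example X.1.5 (method)] -/
theorem finite_point_quadraticTwist_five :
    Finite ((⟨1, 0, 0, -4, -1⟩ : WeierstrassCurve ℚ).quadraticTwist 5).toAffine.Point := by
  have e := (VariableChange.pointEquiv ((⟨1, 0, 0, -4, -1⟩ : WeierstrassCurve ℚ).quadraticTwist 5)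
    (⟨⟨(1 / 2 : ℚ), 2, by norm_num, by norm_num⟩, 0, 0, 0⟩ : VariableChange ℚ)).trans
    (Affine.Point.congrEquiv smul_quadraticTwist_five)
  haveI := Twist525.finite_point
  exact Finite.of_equiv _ e.toEquiv.symm

/-- Over any `ℚ`-algebra `K` that is a field, the base change of `[1, 0, 0, -4, -1]` is the
Weierstrass equation `[1, 0, 0, -4, -1]` over `K`. [folklore] -/
theorem baseChange_eq (K : Type) [Field K] [CharZero K] :
    (⟨1, 0, 0, -4, -1⟩ : WeierstrassCurve ℚ).baseChange K = (⟨1, 0, 0, -4, -1⟩ : WeierstrassCurve K) := by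
  ext <;> simp [baseChange, map]

/-- **The isogeny class `21a` has rank `0` over `ℚ(√5)`: `X₀(21)(K)` is finite for every quadratic
field `K ∋ √5`.**  For a field `K` with `[K:ℚ] = 2` and `r ∈ K`, `r² = 5`, the curve
`21A1 : y² + xy = x³ − 4x − 1` has finitely many `K`-rational points.  Assembly:
`Curve21A1.finite_point` (rank `0` over `ℚ`, complete `2`-descent, tree), `finite_point_quadraticTwist_five`
(rank `0` of the `5`-twist, module `…Rank0TwentyOneTwist525`), and the quadratic finiteness transfer
`finite_point_baseChange_of_finite_of_finite_quadraticTwist` (Silverman *AEC* Exercise 10.16) with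
`θ = r`, `c = 5`.  The NAMED input «rank `21a(ℚ(√5)) = 0`» of sheet 4.5's lineage E10X
(`L(21a,1)·L(21a⊗χ₅,1) ≠ 0` + Kolyvagin–Logachev) as a kernel theorem; torsion over `K` stays that
lineage's `elltors` datum. [cite: SilvermanAEC2009, Exercise 10.16 and Thm. VIII.6.7; CremonaAlgorithms1997, Table 1, N = 21] -/
theorem finite_point_X0_21_of_sq_eq_five (K : Type) [Field K] [CharZero K]
    (hK : Module.finrank ℚ K = 2) {r : K} (hr : r ^ 2 = 5) :
    Finite (⟨1, 0, 0, -4, -1⟩ : WeierstrassCurve K).toAffine.Point := by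
  haveI := Curve21A1.Δ_eq_and_isElliptic.2
  have hc : r ^ 2 = algebraMap ℚ K 5 := by rw [hr, map_ofNat]
  have hfin := (⟨1, 0, 0, -4, -1⟩ : WeierstrassCurve ℚ).finite_point_baseChange_of_finite_of_finite_quadraticTwist
    hK (Rank0Fifteen.sqrt_five_not_mem_range K hr) hc Curve21A1.finite_point
    finite_point_quadraticTwist_five
  rw [baseChange_eq K] at hfin
  exact hfin

end Rank0TwentyOne

end Summit.Langlands.Langlands.Theorems.SqrtFiveQuarticCovers

end
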